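import Mathlib
import Summits.KontsevichZagierPeriods.KontsevichZagierPeriods.Theses.InverseLandau

/-!
# `TateLifting`, line `Sketch`, stub `stub_tateAnalyticContinuation` — analytic continuation of vanishing Tate periods

Crux stmt-KontsevichZagierPeriods-9129 (`Summit.KontsevichZagierPeriods.KontsevichZagierPeriods.Theses.InverseLandau.TateLifting`).
For `P, Q ∈ ℚ[z₁..zₙ, ϖ]` with `Q ≠ 0` on `[0,1]ⁿ × [a,b]`, the PERIOD FUNCTION
`I(ϖ) = ∫_{(0,1)ⁿ} P/Q(z,ϖ) dz` is real-analytic on `[a,b]` — indeed holomorphic in `ϖ` on a complex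
tube around `[a,b]` where `Q` stays non-zero (compactness), by holomorphic dependence on the
parameter under the integral sign — so if it vanishes on a non-empty open subinterval `(c,d) ⊆ [a,b]`
it vanishes on all of `[a,b]` (identity theorem on the connected tube).
-/

noncomputable section

namespace Summit.KontsevichZagierPeriods.InverseLandau

open Literature.NumberTheory.Transcendental
open MeasureTheory Set Filter Metric Topology

/-- Complexification commutes with evaluation of a rational polynomial at a real point.
[folklore] -/
theorem tateLifting_tateAnalyticContinuation_aeval_ofReal {n : ℕ}
    (p : MvPolynomial (Fin (n + 1)) ℚ) (x : Fin (n + 1) → ℝ) :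
    MvPolynomial.aeval (fun j => (x j : ℂ)) p = ((MvPolynomial.aeval x p : ℝ) : ℂ) := by
  rw [show (fun j => (x j : ℂ)) = algebraMap ℝ ℂ ∘ x from rfl,
    MvPolynomial.aeval_algebraMap_apply]
  rfl

/-- Complexifying `Fin.snoc z t` coordinatewise. [folklore] -/
theorem tateLifting_tateAnalyticContinuation_snoc_ofReal {n : ℕ} (z : Fin n → ℝ) (t : ℝ) :
    (Fin.snoc (fun i => (z i : ℂ)) (t : ℂ) : Fin (n + 1) → ℂ) =
      fun j => (((Fin.snoc z t : Fin (n + 1) → ℝ) j : ℝ) : ℂ) := by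
  ext j
  induction j using Fin.lastCases <;> simp

/-- Complex polynomial functions are continuous. [folklore] -/
theorem tateLifting_tateAnalyticContinuation_continuous_aeval {n : ℕ}
    (p : MvPolynomial (Fin (n + 1)) ℚ) :
    Continuous fun x : Fin (n + 1) → ℂ => MvPolynomial.aeval x p := by
  simpa only [MvPolynomial.aeval_def, MvPolynomial.eval_map] using
    MvPolynomial.continuous_eval (MvPolynomial.map (algebraMap ℚ ℂ) p)

/-- Continuity of `(z, w) ↦ (z₁, …, zₙ, w) ∈ ℂⁿ⁺¹` for real `z` and complex `w`.
[folklore] -/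
theorem tateLifting_tateAnalyticContinuation_continuous_snoc {n : ℕ} :
    Continuous fun p : (Fin n → ℝ) × ℂ =>
      (Fin.snoc (fun i => (p.1 i : ℂ)) p.2 : Fin (n + 1) → ℂ) := by
  refine continuous_pi fun j => ?_
  induction j using Fin.lastCases with
  | last => simp only [Fin.snoc_last]; fun_prop
  | cast i => simp only [Fin.snoc_castSucc]; fun_prop

/-- The derivative of `w ↦ p(z, w)` in the last variable is the evaluation of the formal partial
derivative `∂p/∂X_last`. [folklore] -/
theorem tateLifting_tateAnalyticContinuation_hasDerivAt {n : ℕ} (zc : Fin n → ℂ)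
    (p : MvPolynomial (Fin (n + 1)) ℚ) (w : ℂ) :
    HasDerivAt (fun w => MvPolynomial.aeval (Fin.snoc zc w : Fin (n + 1) → ℂ) p)
      (MvPolynomial.aeval (Fin.snoc zc w : Fin (n + 1) → ℂ)
        (MvPolynomial.pderiv (Fin.last n) p)) w := by
  induction p using MvPolynomial.induction_on with
  | C a => simpa using hasDerivAt_const w (algebraMap ℚ ℂ a)
  | add p q hp hq => simpa using hp.fun_add hq
  | mul_X p j hp =>
    have hj : HasDerivAt (fun w : ℂ => (Fin.snoc zc w : Fin (n + 1) → ℂ) j)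
        (MvPolynomial.aeval (Fin.snoc zc w : Fin (n + 1) → ℂ) (MvPolynomial.pderiv (Fin.last n)
          (MvPolynomial.X j : MvPolynomial (Fin (n + 1)) ℚ))) w := by
      induction j using Fin.lastCases with
      | last => simpa using hasDerivAt_id' w
      | cast i =>
        simpa [MvPolynomial.pderiv_X_of_ne (Fin.castSucc_ne_last i)] using
          hasDerivAt_const w (zc i)
    simp only [map_mul, MvPolynomial.aeval_X, MvPolynomial.pderiv_mul, map_add]
    exact hp.fun_mul hj

/-- **Tube lemma**, quantitative in the second factor: a compact `K × L` inside an open `U` admits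
`η > 0` with `K × B̄(w, η) ⊆ U` for every `w` in the `η`-thickening of `L`. [folklore] -/
theorem tateLifting_tateAnalyticContinuation_tube {X : Type*} [PseudoMetricSpace X] {K : Set X}
    {L : Set ℂ} {U : Set (X × ℂ)} (hK : IsCompact K) (hL : IsCompact L) (hU : IsOpen U)
    (hKL : K ×ˢ L ⊆ U) : ∃ η > 0, ∀ w ∈ thickening η L, K ×ˢ closedBall w η ⊆ U := by
  obtain ⟨δ, hδ, hδU⟩ := (hK.prod hL).exists_thickening_subset_open hU hKL
  refine ⟨δ / 2, by positivity, fun w hw => ?_⟩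
  obtain ⟨t, ht, hwt⟩ := mem_thickening_iff.1 hw
  rintro ⟨z, w'⟩ ⟨hz, hw'⟩
  refine hδU (mem_thickening_iff.2 ⟨(z, t), mk_mem_prod hz ht, ?_⟩)
  simp only [mem_closedBall] at hw'
  rw [Prod.dist_eq]
  dsimp only
  rw [dist_self]
  exact max_lt hδ (by linarith [dist_triangle w' w t])

/-- **Holomorphic dependence on a parameter under the integral sign**: if `F` and its
`w`-derivative `F'` are continuous on an open set containing `K × B̄(w, η)` for all `w ∈ W`,
then `w ↦ ∫_S F(z, w) dz` (`S ⊆ K`, `K` compact) is complex-differentiable on `W`. [folklore] -/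
theorem tateLifting_tateAnalyticContinuation_differentiableOn {n : ℕ} {S K : Set (Fin n → ℝ)}
    (hK : IsCompact K) (hSK : S ⊆ K) (hS : MeasurableSet S) {F F' : (Fin n → ℝ) × ℂ → ℂ}
    {U : Set ((Fin n → ℝ) × ℂ)} (hF : ContinuousOn F U) (hF' : ContinuousOn F' U)
    (hder : ∀ p ∈ U, HasDerivAt (fun w => F (p.1, w)) (F' p) p.2) {η : ℝ} (hη : 0 < η)
    {W : Set ℂ} (hW : ∀ w ∈ W, K ×ˢ closedBall w η ⊆ U) :
    DifferentiableOn ℂ (fun w => ∫ z in S, F (z, w)) W := by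
  intro w₀ hw₀
  have hsub := hW w₀ hw₀
  have hsec : ∀ {G : (Fin n → ℝ) × ℂ → ℂ}, ContinuousOn G U →
      ∀ w ∈ closedBall w₀ η, ContinuousOn (fun z => G (z, w)) K := fun hG w hw =>
    hG.comp (f := fun z => (z, w)) (by fun_prop) fun z hz => hsub (mk_mem_prod hz hw)
  obtain ⟨C, hC⟩ :=
    (hK.prod (isCompact_closedBall w₀ η)).exists_bound_of_continuousOn (hF'.mono hsub)
  have hSfin : volume S ≠ ⊤ := ((measure_mono hSK).trans_lt hK.measure_lt_top).ne
  have key := hasDerivAt_integral_of_dominated_loc_of_deriv_le (μ := volume.restrict S)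
    (F := fun w z => F (z, w)) (F' := fun w z => F' (z, w)) (x₀ := w₀) (bound := fun _ => C)
    (closedBall_mem_nhds w₀ hη) ?_ ?_ ?_ ?_ ?_ ?_
  · exact key.2.differentiableAt.differentiableWithinAt
  · exact eventually_of_mem (closedBall_mem_nhds w₀ hη) fun w hw =>
      ((hsec hF w hw).mono hSK).aestronglyMeasurable hS
  · exact ((hsec hF w₀ (mem_closedBall_self hη.le)).integrableOn_compact hK).mono_set hSK
  · exact ((hsec hF' w₀ (mem_closedBall_self hη.le)).mono hSK).aestronglyMeasurable hS
  · exact ae_restrict_of_forall_mem hS fun z hz w hw => hC (z, w) (mk_mem_prod (hSK hz) hw)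
  · exact integrableOn_const hSfin
  · exact ae_restrict_of_forall_mem hS fun z hz w hw =>
      hder (z, w) (hsub (mk_mem_prod (hSK hz) hw))

/-- **Identity theorem on a convex tube**: a holomorphic function on an open convex set meeting
the real axis, whose restriction to the reals vanishes near a real point of the set, vanishes
identically. [folklore] -/
theorem tateLifting_tateAnalyticContinuation_identity {G : ℂ → ℂ} {W : Set ℂ} (hWo : IsOpen W)
    (hWc : Convex ℝ W) (hG : DifferentiableOn ℂ G W) {x₀ : ℝ} (hx₀ : (x₀ : ℂ) ∈ W)
    (hvan : ∀ᶠ t : ℝ in 𝓝 x₀, G t = 0) : EqOn G 0 W := by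
  refine (hG.analyticOnNhd hWo).eqOn_zero_of_preconnected_of_frequently_eq_zero
    hWc.isPreconnected hx₀ ?_
  have ht : Tendsto (fun t : ℝ => (t : ℂ)) (𝓝[≠] x₀) (𝓝[≠] (x₀ : ℂ)) :=
    Complex.continuous_ofReal.continuousWithinAt.tendsto_nhdsWithin fun t ht => by
      simpa using ht
  exact ht.frequently (hvan.filter_mono nhdsWithin_le_nhds).frequently

/-- **Analytic continuation of vanishing Tate periods** (stub `stub_tateAnalyticContinuation` of
line `Sketch` for crux `TateLifting`). [folklore] -/
theorem tateLifting_tateAnalyticContinuation :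
    ∀ (n : ℕ) (P Q : MvPolynomial (Fin (n + 1)) ℚ) (a b c d : ℝ), a ≤ c → c < d → d ≤ b →
      (∀ (z : Fin n → ℝ) (ϖ : ℝ), (∀ i, z i ∈ Set.Icc (0 : ℝ) 1) → ϖ ∈ Set.Icc a b →
        MvPolynomial.aeval (Fin.snoc z ϖ : Fin (n + 1) → ℝ) Q ≠ 0) →
      (∀ ϖ ∈ Set.Ioo c d, ∫ z in Set.pi Set.univ (fun _ : Fin n => Set.Ioo (0 : ℝ) 1),
        MvPolynomial.aeval (Fin.snoc z ϖ : Fin (n + 1) → ℝ) P /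
          MvPolynomial.aeval (Fin.snoc z ϖ : Fin (n + 1) → ℝ) Q = 0) →
      ∀ ϖ ∈ Set.Icc a b, ∫ z in Set.pi Set.univ (fun _ : Fin n => Set.Ioo (0 : ℝ) 1),
        MvPolynomial.aeval (Fin.snoc z ϖ : Fin (n + 1) → ℝ) P /
          MvPolynomial.aeval (Fin.snoc z ϖ : Fin (n + 1) → ℝ) Q = 0 := by
  intro n P Q a b c d hac hcd hdb hQ hvan ϖ hϖ
  -- complexified evaluation `ev R (z, w) = R(z, w)` for real `z` and complex `w`
  obtain ⟨ev, hev⟩ : ∃ ev : MvPolynomial (Fin (n + 1)) ℚ → (Fin n → ℝ) × ℂ → ℂ, ∀ R p,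
      ev R p = MvPolynomial.aeval (Fin.snoc (fun i => (p.1 i : ℂ)) p.2 : Fin (n + 1) → ℂ) R :=
    ⟨_, fun _ _ => rfl⟩
  have hevc : ∀ R, Continuous (ev R) := fun R => by
    rw [funext (hev R)]
    exact (tateLifting_tateAnalyticContinuation_continuous_aeval R).comp
      tateLifting_tateAnalyticContinuation_continuous_snoc
  have hreal : ∀ R (z : Fin n → ℝ) (t : ℝ), ev R (z, (t : ℂ)) =
      ((MvPolynomial.aeval (Fin.snoc z t : Fin (n + 1) → ℝ) R : ℝ) : ℂ) := by
    intro R z t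
    simp only [hev]
    rw [tateLifting_tateAnalyticContinuation_snoc_ofReal,
      tateLifting_tateAnalyticContinuation_aeval_ofReal]
  have hGreal : ∀ t : ℝ, (∫ z in Set.pi Set.univ (fun _ : Fin n => Set.Ioo (0 : ℝ) 1),
      ev P (z, (t : ℂ)) / ev Q (z, (t : ℂ))) =
      ((∫ z in Set.pi Set.univ (fun _ : Fin n => Set.Ioo (0 : ℝ) 1),
        MvPolynomial.aeval (Fin.snoc z t : Fin (n + 1) → ℝ) P /
          MvPolynomial.aeval (Fin.snoc z t : Fin (n + 1) → ℝ) Q : ℝ) : ℂ) := fun t => by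
    simp_rw [hreal, ← Complex.ofReal_div]
    exact integral_complex_ofReal
  -- the open set where `Q ≠ 0`, the closed cube `K`, the real parameter segment `L`
  set U : Set ((Fin n → ℝ) × ℂ) := {p | ev Q p ≠ 0} with hU
  have hUo : IsOpen U := isOpen_ne_fun (hevc Q) continuous_const
  set K : Set (Fin n → ℝ) := Set.pi Set.univ fun _ => Set.Icc (0 : ℝ) 1 with hK
  have hKc : IsCompact K := isCompact_univ_pi fun _ => isCompact_Icc
  set L : Set ℂ := (fun t : ℝ => (t : ℂ)) '' Set.Icc a b with hL
  have hLc : IsCompact L := isCompact_Icc.image Complex.continuous_ofReal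
  have hmemL : ∀ t ∈ Set.Icc a b, (t : ℂ) ∈ L := fun t ht => mem_image_of_mem _ ht
  have hKL : K ×ˢ L ⊆ U := by
    rintro ⟨z, w⟩ ⟨hz, t, ht, rfl⟩
    show ev Q (z, (t : ℂ)) ≠ 0
    rw [hreal, Complex.ofReal_ne_zero]
    exact hQ z t (fun i => Set.mem_univ_pi.1 hz i) ht
  obtain ⟨η, hη, hηU⟩ := tateLifting_tateAnalyticContinuation_tube hKc hLc hUo hKL
  -- holomorphy of the complexified period function on the tube `thickening η L`
  set S : Set (Fin n → ℝ) := Set.pi Set.univ fun _ : Fin n => Set.Ioo (0 : ℝ) 1 with hS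
  have hSK : S ⊆ K := Set.pi_mono fun _ _ => Set.Ioo_subset_Icc_self
  have hSm : MeasurableSet S := MeasurableSet.univ_pi fun _ => measurableSet_Ioo
  have hF : ContinuousOn (fun p => ev P p / ev Q p) U :=
    (hevc P).continuousOn.div₀ (hevc Q).continuousOn fun p hp => hp
  have hF' : ContinuousOn (fun p => (ev (MvPolynomial.pderiv (Fin.last n) P) p * ev Q p -
      ev P p * ev (MvPolynomial.pderiv (Fin.last n) Q) p) / ev Q p ^ 2) U :=
    (((hevc _).fun_mul (hevc Q)).fun_sub ((hevc P).fun_mul (hevc _))).continuousOn.div₀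
      ((hevc Q).fun_pow 2).continuousOn fun p hp => pow_ne_zero 2 hp
  have hder : ∀ p ∈ U, HasDerivAt (fun w => ev P (p.1, w) / ev Q (p.1, w))
      ((ev (MvPolynomial.pderiv (Fin.last n) P) p * ev Q p -
        ev P p * ev (MvPolynomial.pderiv (Fin.last n) Q) p) / ev Q p ^ 2) p.2 := by
    rintro ⟨z, w⟩ hp
    have hq : ev Q (z, w) ≠ 0 := hp
    simp only [hev] at hq ⊢
    exact (tateLifting_tateAnalyticContinuation_hasDerivAt _ P w).fun_div
      (tateLifting_tateAnalyticContinuation_hasDerivAt _ Q w) hq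
  have hdiff :=
    tateLifting_tateAnalyticContinuation_differentiableOn hKc hSK hSm hF hF' hder hη hηU
  -- identity theorem on the convex tube
  have hWc : Convex ℝ (thickening η L) :=
    ((convex_Icc a b).is_linear_image (f := fun t : ℝ => (t : ℂ))
      ⟨fun x y => by simp, fun c x => by simp⟩).thickening η
  have hLW : L ⊆ thickening η L := self_subset_thickening hη L
  have hzero := tateLifting_tateAnalyticContinuation_identity isOpen_thickening hWc hdiff
    (hLW (hmemL ((c + d) / 2) ⟨by linarith, by linarith⟩)) (by
      filter_upwards [Ioo_mem_nhds (show c < (c + d) / 2 by linarith)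
        (show (c + d) / 2 < d by linarith)] with t ht
      rw [hGreal, Complex.ofReal_eq_zero]
      exact hvan t ht)
  have h1 := hzero (hLW (hmemL ϖ hϖ))
  simp only [Pi.zero_apply, hGreal, Complex.ofReal_eq_zero] at h1
  exact h1

end Summit.KontsevichZagierPeriods.InverseLandau

end
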